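import Summits.MatrixMultiplication.MatrixMultiplication.Theorems.SoloBlindErdosRadoLayer

/-!
# L(2) = 4 for zero-sum-free sequences in exponent 3 (solo-blind, door I1⁗ / (K₃), s80)

Let `h : ι → G` take values in an abelian group of exponent `3` (`g + g + g = 0`) and be zero-sum free on
the finite index set `S`.  THEOREM (all ranks, all lengths; sharp):

  for every `τ`, at most FOUR 2-subsets `{i, j} ⊆ S` have `h i + h j = τ`

(`soloBlind_seqRep_two_card_le_four`), and `4` is attained by the doubled basis `(e₀, e₀, e₁, e₁)`,
`τ = e₀ + e₁` (`soloBlind_seqRep_two_four_attained`).  This is the layer-`2` case `L(2)` of the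
conjectured layer bound `N_k(τ) ≤ 2^k` (the rank-free kernel bound of `SoloBlindErdosRadoLayer` gives
only `2^2 · 2! = 8` here).

Proof (value classes).  A representation `{i, j}` has the VALUE PAIR `{h i, h j}`; two value pairs with
sum `τ` are equal or disjoint, so representations with different value pairs are disjoint.  (1) Three
pairwise different value pairs give three pairwise disjoint representations, a zero-sum (`3τ = 0`).
(2) A representation with equal values `h i = h j = a` (`τ = a + a`) excludes every other value pair
`{c, d}`: `a + c + d = a + a + a = 0`.  (3) At most two indices share a value (`a + a + a = 0`), so a value
pair `{a, b}`, `a ≠ b`, carries at most `m(a) · m(b) ≤ 4` representations and a singleton value pair at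
most one.  (4) If `{a, b}` carries `≥ 3` representations then `m(a) = m(b) = 2`, and any representation
`T` with another value pair yields the zero-sum `(a + a) + (b + b) + Σ_T h = 3a + 3b = 0`; so when two value
pairs occur each carries at most `2`.  Hence `N_2(τ) ≤ max (4, 1, 2 + 2) = 4`.
-/

namespace Summit.MatrixMultiplication.MatrixMultiplication.Theorems

open Finset

variable {ι G : Type*} [DecidableEq ι] [AddCommGroup G] [DecidableEq G]

omit [DecidableEq ι] in
/-- VALUE CLASSES HAVE AT MOST TWO INDICES: three indices with the same value form a zero-sum. -/
theorem soloBlind_valueClass_card_le_two (three : ∀ g : G, g + g + g = 0) (h : ι → G)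
    (S : Finset ι) (zsf : ∀ T ⊆ S, T.Nonempty → ∑ i ∈ T, h i ≠ 0) (a : G) :
    (S.filter (fun i => h i = a)).card ≤ 2 := by
  by_contra hlt
  have h3 : 3 ≤ (S.filter (fun i => h i = a)).card := by omega
  obtain ⟨Z, hZsub, hZcard⟩ := Finset.exists_subset_card_eq h3
  have hZS : Z ⊆ S := hZsub.trans (Finset.filter_subset _ _)
  have hsum : ∑ i ∈ Z, h i = 0 := by
    calc ∑ i ∈ Z, h i = ∑ i ∈ Z, a :=
          Finset.sum_congr rfl (fun i hi => (Finset.mem_filter.mp (hZsub hi)).2)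
      _ = Z.card • a := Finset.sum_const a
      _ = 0 := by rw [hZcard, succ_nsmul, two_nsmul]; exact three a
  exact zsf Z hZS (Finset.card_pos.mp (by omega)) hsum

omit [DecidableEq ι] in
/-- The sum of `h` over a value class is `card • value`. -/
theorem soloBlind_sum_valueClass (h : ι → G) (S : Finset ι) (a : G) :
    ∑ i ∈ S.filter (fun i => h i = a), h i = (S.filter (fun i => h i = a)).card • a := by
  calc ∑ i ∈ S.filter (fun i => h i = a), h i = ∑ i ∈ S.filter (fun i => h i = a), a :=
        Finset.sum_congr rfl (fun i hi => (Finset.mem_filter.mp hi).2)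
    _ = (S.filter (fun i => h i = a)).card • a := Finset.sum_const a

/-- A size-`2` representation is a pair `{x, y}` of distinct indices of `S` with `h x + h y = τ`. -/
theorem soloBlind_mem_seqRep_two {h : ι → G} {S : Finset ι} {τ : G} {T : Finset ι}
    (hT : T ∈ soloBlindSeqRep h S 2 τ) :
    ∃ x y, x ≠ y ∧ T = {x, y} ∧ x ∈ S ∧ y ∈ S ∧ h x + h y = τ := by
  classical
  obtain ⟨hTS, hcard, hsum⟩ := soloBlind_mem_seqRep.mp hT
  obtain ⟨x, y, hxy, rfl⟩ := Finset.card_eq_two.mp hcard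
  refine ⟨x, y, hxy, rfl, hTS (by simp), hTS (by simp), ?_⟩
  rw [Finset.sum_pair hxy] at hsum
  exact hsum

omit [AddCommGroup G] in
/-- The value pair of `{x, y}` is `{h x, h y}`. -/
theorem soloBlind_image_pair (h : ι → G) (x y : ι) :
    ({x, y} : Finset ι).image h = {h x, h y} := by
  rw [Finset.image_insert, Finset.image_singleton]

omit [DecidableEq ι] in
/-- Two value pairs with the same sum are EQUAL OR DISJOINT. -/
theorem soloBlind_valuePair_eq_of_not_disjoint {a b c d τ : G}
    (hab : a + b = τ) (hcd : c + d = τ) (hnd : ¬ Disjoint ({a, b} : Finset G) {c, d}) :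
    ({a, b} : Finset G) = {c, d} := by
  rw [Finset.not_disjoint_iff] at hnd
  obtain ⟨v, hv1, hv2⟩ := hnd
  simp only [Finset.mem_insert, Finset.mem_singleton] at hv1 hv2
  have ha : a = τ - b := by rw [← hab]; abel
  have hb : b = τ - a := by rw [← hab]; abel
  have hc : c = τ - d := by rw [← hcd]; abel
  have hd : d = τ - c := by rw [← hcd]; abel
  rcases hv1 with rfl | rfl
  · rcases hv2 with h2 | h2
    · -- v = a = c, hence b = d
      have hbd : b = d := by rw [hb, hd, h2]
      rw [h2, hbd]
    · -- v = a = d, hence b = c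
      have hbc : b = c := by rw [hb, hc, h2]
      rw [h2, hbc, Finset.pair_comm]
  · rcases hv2 with h2 | h2
    · -- v = b = c, hence a = d
      have had : a = d := by rw [ha, hd, h2]
      rw [h2, had, Finset.pair_comm]
    · -- v = b = d, hence a = c
      have hac : a = c := by rw [ha, hc, h2]
      rw [h2, hac]

/-- Size-`2` representations of `τ` have EQUAL OR DISJOINT value pairs. -/
theorem soloBlind_rep2_image_eq_or_disjoint {h : ι → G} {S : Finset ι} {τ : G}
    {T₁ T₂ : Finset ι} (h₁ : T₁ ∈ soloBlindSeqRep h S 2 τ) (h₂ : T₂ ∈ soloBlindSeqRep h S 2 τ) :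
    T₁.image h = T₂.image h ∨ Disjoint (T₁.image h) (T₂.image h) := by
  obtain ⟨x, y, _, rfl, _, _, hs₁⟩ := soloBlind_mem_seqRep_two h₁
  obtain ⟨x', y', _, rfl, _, _, hs₂⟩ := soloBlind_mem_seqRep_two h₂
  rw [soloBlind_image_pair, soloBlind_image_pair]
  by_cases hd : Disjoint ({h x, h y} : Finset G) {h x', h y'}
  · exact Or.inr hd
  · exact Or.inl (soloBlind_valuePair_eq_of_not_disjoint hs₁ hs₂ hd)

omit [DecidableEq ι] [AddCommGroup G] in
/-- Representations with disjoint value pairs are disjoint. -/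
theorem soloBlind_disjoint_of_image_disjoint {h : ι → G} {T₁ T₂ : Finset ι}
    (hd : Disjoint (T₁.image h) (T₂.image h)) : Disjoint T₁ T₂ :=
  Finset.disjoint_left.mpr (fun _ hx₁ hx₂ =>
    Finset.disjoint_left.mp hd (Finset.mem_image_of_mem h hx₁) (Finset.mem_image_of_mem h hx₂))

/-- (1) NO THREE VALUE PAIRS: three representations with pairwise disjoint value pairs are pairwise
disjoint and unite to a zero-sum (`τ + τ + τ = 0`). -/
theorem soloBlind_rep2_no_three_classes (three : ∀ g : G, g + g + g = 0) {h : ι → G} {S : Finset ι}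
    (zsf : ∀ T ⊆ S, T.Nonempty → ∑ i ∈ T, h i ≠ 0) {τ : G} {T₁ T₂ T₃ : Finset ι}
    (h₁ : T₁ ∈ soloBlindSeqRep h S 2 τ) (h₂ : T₂ ∈ soloBlindSeqRep h S 2 τ)
    (h₃ : T₃ ∈ soloBlindSeqRep h S 2 τ) (d₁₂ : Disjoint (T₁.image h) (T₂.image h))
    (d₁₃ : Disjoint (T₁.image h) (T₃.image h)) (d₂₃ : Disjoint (T₂.image h) (T₃.image h)) :
    False := by
  have hd : Disjoint T₁ T₂ := soloBlind_disjoint_of_image_disjoint d₁₂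
  obtain ⟨z, hz⟩ := soloBlind_rep_meets_pair (k := 1) three zsf h₁ h₂ h₃ hd
  rw [Finset.mem_inter, Finset.mem_union] at hz
  rcases hz.2 with hz₁ | hz₂
  · exact Finset.disjoint_left.mp (soloBlind_disjoint_of_image_disjoint d₁₃) hz₁ hz.1
  · exact Finset.disjoint_left.mp (soloBlind_disjoint_of_image_disjoint d₂₃) hz₂ hz.1

/-- (2) A REPRESENTATION WITH EQUAL VALUES IS ALONE: if `h x = h y` for the representation `{x, y}`
(so `τ = a + a`), then no representation has a different value pair (`a + (c + d) = a + a + a = 0`). -/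
theorem soloBlind_rep2_twin_alone (three : ∀ g : G, g + g + g = 0) {h : ι → G} {S : Finset ι}
    (zsf : ∀ T ⊆ S, T.Nonempty → ∑ i ∈ T, h i ≠ 0) {τ : G} {x y : ι} {T₂ : Finset ι}
    (h₁ : ({x, y} : Finset ι) ∈ soloBlindSeqRep h S 2 τ) (hxy : h x = h y)
    (h₂ : T₂ ∈ soloBlindSeqRep h S 2 τ) (hne : T₂.image h ≠ ({x, y} : Finset ι).image h) :
    False := by
  have hdis : Disjoint (({x, y} : Finset ι).image h) (T₂.image h) := by
    rcases soloBlind_rep2_image_eq_or_disjoint h₁ h₂ with he | hd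
    · exact absurd he.symm hne
    · exact hd
  obtain ⟨_, _, _, hS₁, _, hs₁⟩ : ∃ x' y', x' ≠ y' ∧ ({x, y} : Finset ι) = {x', y'} ∧
      x' ∈ S ∧ y' ∈ S ∧ h x' + h y' = τ := soloBlind_mem_seqRep_two h₁
  obtain ⟨hT₁S, _, hsum₁⟩ := soloBlind_mem_seqRep.mp h₁
  obtain ⟨hT₂S, hcard₂, hsum₂⟩ := soloBlind_mem_seqRep.mp h₂
  have hxS : x ∈ S := hT₁S (by simp)
  have hxT₂ : x ∉ T₂ := by
    intro hx
    have h1 : h x ∈ ({x, y} : Finset ι).image h := Finset.mem_image_of_mem h (by simp)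
    have h2 : h x ∈ T₂.image h := Finset.mem_image_of_mem h hx
    exact Finset.disjoint_left.mp hdis h1 h2
  -- the sum over {x, y} is h x + h x
  have hτ : τ = h x + h x := by
    have hxy' : ∑ i ∈ ({x, y} : Finset ι), h i = τ := hsum₁
    by_cases hxyeq : x = y
    · -- then {x, y} = {x} has card 1, not 2: impossible
      obtain ⟨_, hc, _⟩ := soloBlind_mem_seqRep.mp h₁
      rw [hxyeq] at hc
      simp at hc
    · rw [Finset.sum_pair hxyeq, ← hxy] at hxy'
      exact hxy'.symm
  have hZsum : ∑ i ∈ insert x T₂, h i = 0 := by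
    rw [Finset.sum_insert hxT₂, hsum₂, hτ, ← add_assoc]
    exact three (h x)
  have hZS : insert x T₂ ⊆ S := Finset.insert_subset hxS hT₂S
  exact zsf _ hZS (Finset.insert_nonempty x T₂) hZsum

/-- (3a) A value pair `{a, b}` with `a ≠ b` carries at most `m(a) · m(b)` representations
(`m` = value-class size). -/
theorem soloBlind_rep2_fibre_le_mul (h : ι → G) (S : Finset ι) (τ : G) {a b : G} (hab : a ≠ b) :
    ((soloBlindSeqRep h S 2 τ).filter (fun T => T.image h = {a, b})).card
      ≤ (S.filter (fun i => h i = a)).card * (S.filter (fun i => h i = b)).card := by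
  have hcover : (soloBlindSeqRep h S 2 τ).filter (fun T => T.image h = {a, b}) ⊆
      (S.filter (fun i => h i = a)).biUnion
        (fun u => (S.filter (fun i => h i = b)).image (fun v => ({u, v} : Finset ι))) := by
    intro T hT
    rw [Finset.mem_filter] at hT
    obtain ⟨x, y, _, rfl, hxS, hyS, _⟩ := soloBlind_mem_seqRep_two hT.1
    have himg : ({h x, h y} : Finset G) = {a, b} := by rw [← soloBlind_image_pair]; exact hT.2
    have hxm : h x ∈ ({a, b} : Finset G) := by rw [← himg]; simp
    have hym : h y ∈ ({a, b} : Finset G) := by rw [← himg]; simp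
    have ham : a ∈ ({h x, h y} : Finset G) := by rw [himg]; simp
    have hbm : b ∈ ({h x, h y} : Finset G) := by rw [himg]; simp
    simp only [Finset.mem_insert, Finset.mem_singleton] at hxm hym ham hbm
    rw [Finset.mem_biUnion]
    rcases hxm with hxa | hxb
    · -- h x = a, then h y = b
      have hyb : h y = b := by
        rcases hym with hya | hyb
        · exact absurd (hbm.elim (fun e => e.trans hxa) (fun e => e.trans hya)) (Ne.symm hab)
        · exact hyb
      exact ⟨x, Finset.mem_filter.mpr ⟨hxS, hxa⟩,
        Finset.mem_image.mpr ⟨y, Finset.mem_filter.mpr ⟨hyS, hyb⟩, rfl⟩⟩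
    · -- h x = b, then h y = a
      have hya : h y = a := by
        rcases hym with hya | hyb
        · exact hya
        · exact absurd (ham.elim (fun e => e.trans hxb) (fun e => e.trans hyb)) hab
      exact ⟨y, Finset.mem_filter.mpr ⟨hyS, hya⟩,
        Finset.mem_image.mpr ⟨x, Finset.mem_filter.mpr ⟨hxS, hxb⟩, Finset.pair_comm y x⟩⟩
  calc ((soloBlindSeqRep h S 2 τ).filter (fun T => T.image h = {a, b})).card
      ≤ ((S.filter (fun i => h i = a)).biUnion
          (fun u => (S.filter (fun i => h i = b)).image (fun v => ({u, v} : Finset ι)))).card :=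
        Finset.card_le_card hcover
    _ ≤ ∑ u ∈ S.filter (fun i => h i = a),
          ((S.filter (fun i => h i = b)).image (fun v => ({u, v} : Finset ι))).card :=
        Finset.card_biUnion_le
    _ ≤ ∑ u ∈ S.filter (fun i => h i = a), (S.filter (fun i => h i = b)).card :=
        Finset.sum_le_sum (fun u _ => Finset.card_image_le)
    _ = (S.filter (fun i => h i = a)).card * (S.filter (fun i => h i = b)).card := by
        rw [Finset.sum_const, smul_eq_mul]

omit [DecidableEq ι] in
/-- (3b) A singleton value pair `{a}` carries at most one representation (the value class of `a` has at
most two indices). -/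
theorem soloBlind_rep2_fibre_singleton_le_one (three : ∀ g : G, g + g + g = 0) (h : ι → G)
    (S : Finset ι) (zsf : ∀ T ⊆ S, T.Nonempty → ∑ i ∈ T, h i ≠ 0) (τ : G) (a : G) :
    ((soloBlindSeqRep h S 2 τ).filter (fun T => T.image h = {a})).card ≤ 1 := by
  have hcover : (soloBlindSeqRep h S 2 τ).filter (fun T => T.image h = {a}) ⊆
      (S.filter (fun i => h i = a)).powersetCard 2 := by
    intro T hT
    rw [Finset.mem_filter] at hT
    obtain ⟨hTS, hcard, _⟩ := soloBlind_mem_seqRep.mp hT.1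
    rw [Finset.mem_powersetCard]
    refine ⟨?_, hcard⟩
    intro z hz
    have hz' : h z ∈ T.image h := Finset.mem_image_of_mem h hz
    rw [hT.2, Finset.mem_singleton] at hz'
    exact Finset.mem_filter.mpr ⟨hTS hz, hz'⟩
  calc ((soloBlindSeqRep h S 2 τ).filter (fun T => T.image h = {a})).card
      ≤ ((S.filter (fun i => h i = a)).powersetCard 2).card := Finset.card_le_card hcover
    _ = ((S.filter (fun i => h i = a)).card).choose 2 := Finset.card_powersetCard _ _
    _ ≤ (2 : ℕ).choose 2 := Nat.choose_le_choose 2 (soloBlind_valueClass_card_le_two three h S zsf a)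
    _ = 1 := by norm_num

/-- (4) TWO VALUE PAIRS FORCE SMALL FIBRES: if the representation `{x, y}` has `h x ≠ h y` and some
representation `T₂` has a value pair disjoint from `{h x, h y}`, then `{h x, h y}` carries at most `2`
representations — otherwise both value classes have two indices and `(class of h x) ∪ (class of h y) ∪ T₂`
is a zero-sum. -/
theorem soloBlind_rep2_fibre_le_two (three : ∀ g : G, g + g + g = 0) {h : ι → G} {S : Finset ι}
    (zsf : ∀ T ⊆ S, T.Nonempty → ∑ i ∈ T, h i ≠ 0) {τ : G} {x y : ι} {T₂ : Finset ι}
    (h₁ : ({x, y} : Finset ι) ∈ soloBlindSeqRep h S 2 τ) (hxy : h x ≠ h y)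
    (h₂ : T₂ ∈ soloBlindSeqRep h S 2 τ)
    (hdis : Disjoint (({x, y} : Finset ι).image h) (T₂.image h)) :
    ((soloBlindSeqRep h S 2 τ).filter (fun T => T.image h = {h x, h y})).card ≤ 2 := by
  set A := S.filter (fun i => h i = h x) with hA
  set B := S.filter (fun i => h i = h y) with hB
  have hAle : A.card ≤ 2 := soloBlind_valueClass_card_le_two three h S zsf (h x)
  have hBle : B.card ≤ 2 := soloBlind_valueClass_card_le_two three h S zsf (h y)
  have hfib := soloBlind_rep2_fibre_le_mul h S τ hxy
  by_contra hgt
  have h3 : 3 ≤ A.card * B.card := by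
    have : 3 ≤ ((soloBlindSeqRep h S 2 τ).filter (fun T => T.image h = {h x, h y})).card := by omega
    exact this.trans hfib
  have hA2 : A.card = 2 := by
    rcases Nat.lt_or_ge A.card 2 with hlt | hge
    · interval_cases (A.card) <;> omega
    · omega
  have hB2 : B.card = 2 := by
    rcases Nat.lt_or_ge B.card 2 with hlt | hge
    · interval_cases (B.card) <;> omega
    · omega
  -- the zero-sum  A ∪ B ∪ T₂
  obtain ⟨hT₁S, hcard₁, hsum₁⟩ := soloBlind_mem_seqRep.mp h₁
  obtain ⟨hT₂S, hcard₂, hsum₂⟩ := soloBlind_mem_seqRep.mp h₂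
  have hxyne : x ≠ y := fun e => hxy (by rw [e])
  have hτ : h x + h y = τ := by rw [Finset.sum_pair hxyne] at hsum₁; exact hsum₁
  have hdAB : Disjoint A B := by
    rw [hA, hB, Finset.disjoint_filter]
    intro i _ hia hib
    exact hxy (hia.symm.trans hib)
  have hdABT : Disjoint (A ∪ B) T₂ := by
    rw [Finset.disjoint_left]
    intro z hz hzT
    have hzimg : h z ∈ T₂.image h := Finset.mem_image_of_mem h hzT
    have hzval : h z ∈ ({x, y} : Finset ι).image h := by
      rw [soloBlind_image_pair, Finset.mem_insert, Finset.mem_singleton]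
      rcases Finset.mem_union.mp hz with hzA | hzB
      · exact Or.inl (Finset.mem_filter.mp hzA).2
      · exact Or.inr (Finset.mem_filter.mp hzB).2
    exact Finset.disjoint_left.mp hdis hzval hzimg
  have hsumA : ∑ i ∈ A, h i = h x + h x := by
    rw [hA, soloBlind_sum_valueClass, ← hA, hA2, two_nsmul]
  have hsumB : ∑ i ∈ B, h i = h y + h y := by
    rw [hB, soloBlind_sum_valueClass, ← hB, hB2, two_nsmul]
  have hZsum : ∑ i ∈ (A ∪ B) ∪ T₂, h i = 0 := by
    rw [Finset.sum_union hdABT, Finset.sum_union hdAB, hsumA, hsumB, hsum₂, ← hτ]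
    have e : h x + h x + (h y + h y) + (h x + h y) = (h x + h x + h x) + (h y + h y + h y) := by abel
    rw [e, three (h x), three (h y), add_zero]
  have hZS : (A ∪ B) ∪ T₂ ⊆ S :=
    Finset.union_subset (Finset.union_subset (Finset.filter_subset _ _) (Finset.filter_subset _ _)) hT₂S
  have hZne : ((A ∪ B) ∪ T₂).Nonempty := by
    have : T₂.Nonempty := Finset.card_pos.mp (by omega)
    obtain ⟨z, hz⟩ := this
    exact ⟨z, Finset.mem_union_right _ hz⟩
  exact zsf _ hZS hZne hZsum

/-- THEOREM L(2) (all ranks, all lengths).  A zero-sum-free sequence in an abelian group of exponent `3`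
has at most FOUR size-`2` representations of any element `τ`. -/
theorem soloBlind_seqRep_two_card_le_four (three : ∀ g : G, g + g + g = 0) (h : ι → G)
    (S : Finset ι) (zsf : ∀ T ⊆ S, T.Nonempty → ∑ i ∈ T, h i ≠ 0) (τ : G) :
    (soloBlindSeqRep h S 2 τ).card ≤ 4 := by
  set E := soloBlindSeqRep h S 2 τ with hE
  by_cases hempty : E = ∅
  · rw [hempty]; simp
  obtain ⟨T₁, hT₁⟩ := Finset.nonempty_iff_ne_empty.mpr hempty
  obtain ⟨x, y, hxyne, rfl, hxS, hyS, hsum⟩ := soloBlind_mem_seqRep_two hT₁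
  by_cases hxy : h x = h y
  · -- every representation has the value pair {h x}: at most one
    have hsub : E ⊆ E.filter (fun T => T.image h = {h x}) := by
      intro T hT
      rw [Finset.mem_filter]
      refine ⟨hT, ?_⟩
      by_contra hne
      have hne' : T.image h ≠ ({x, y} : Finset ι).image h := by
        rw [soloBlind_image_pair, ← hxy, Finset.pair_eq_singleton]  -- {h x, h x} = {h x}
        exact hne
      exact soloBlind_rep2_twin_alone three zsf hT₁ hxy hT hne'
    calc E.card ≤ (E.filter (fun T => T.image h = {h x})).card := Finset.card_le_card hsub
      _ ≤ 1 := soloBlind_rep2_fibre_singleton_le_one three h S zsf τ (h x)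
      _ ≤ 4 := by norm_num
  · by_cases hall : ∀ T ∈ E, T.image h = {h x, h y}
    · -- one value pair: at most m(h x) · m(h y) ≤ 4
      have hfilt : E.filter (fun T => T.image h = {h x, h y}) = E := Finset.filter_true_of_mem hall
      calc E.card = (E.filter (fun T => T.image h = {h x, h y})).card := by rw [hfilt]
        _ ≤ (S.filter (fun i => h i = h x)).card * (S.filter (fun i => h i = h y)).card :=
            soloBlind_rep2_fibre_le_mul h S τ hxy
        _ ≤ 2 * 2 := Nat.mul_le_mul (soloBlind_valueClass_card_le_two three h S zsf (h x))
            (soloBlind_valueClass_card_le_two three h S zsf (h y))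
        _ = 4 := by norm_num
    · -- two value pairs (a third is impossible): each carries at most 2
      push Not at hall
      obtain ⟨T₂, hT₂, hne₂⟩ := hall
      have himg₁ : ({x, y} : Finset ι).image h = {h x, h y} := soloBlind_image_pair h x y
      have hd₁₂ : Disjoint (({x, y} : Finset ι).image h) (T₂.image h) := by
        rcases soloBlind_rep2_image_eq_or_disjoint hT₁ hT₂ with he | hd
        · exact absurd (he.symm.trans himg₁) hne₂
        · exact hd
      obtain ⟨x', y', hxyne', rfl, hx'S, hy'S, hsum'⟩ := soloBlind_mem_seqRep_two hT₂
      have hxy' : h x' ≠ h y' := by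
        intro heq
        exact soloBlind_rep2_twin_alone three zsf hT₂ heq hT₁
          (fun e => hne₂ (by rw [← e, himg₁]))
      have himg₂ : ({x', y'} : Finset ι).image h = {h x', h y'} := soloBlind_image_pair h x' y'
      -- every representation has one of the two value pairs
      have hcover : E ⊆ E.filter (fun T => T.image h = {h x, h y}) ∪
          E.filter (fun T => T.image h = {h x', h y'}) := by
        intro T hT
        rw [Finset.mem_union, Finset.mem_filter, Finset.mem_filter]
        rcases soloBlind_rep2_image_eq_or_disjoint hT hT₁ with he₁ | hd₁
        · exact Or.inl ⟨hT, he₁.trans himg₁⟩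
        · rcases soloBlind_rep2_image_eq_or_disjoint hT hT₂ with he₂ | hd₂
          · exact Or.inr ⟨hT, he₂.trans himg₂⟩
          · exact (soloBlind_rep2_no_three_classes three zsf hT₁ hT₂ hT hd₁₂ hd₁.symm hd₂.symm).elim
      have hf₁ : (E.filter (fun T => T.image h = {h x, h y})).card ≤ 2 :=
        soloBlind_rep2_fibre_le_two three zsf hT₁ hxy hT₂ hd₁₂
      have hf₂ : (E.filter (fun T => T.image h = {h x', h y'})).card ≤ 2 :=
        soloBlind_rep2_fibre_le_two three zsf hT₂ hxy' hT₁ hd₁₂.symm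
      calc E.card ≤ (E.filter (fun T => T.image h = {h x, h y}) ∪
            E.filter (fun T => T.image h = {h x', h y'})).card := Finset.card_le_card hcover
        _ ≤ (E.filter (fun T => T.image h = {h x, h y})).card +
            (E.filter (fun T => T.image h = {h x', h y'})).card := Finset.card_union_le _ _
        _ ≤ 2 + 2 := Nat.add_le_add hf₁ hf₂
        _ = 4 := by norm_num

/-- The same bound over `𝔽₃^r` (`G = Fin r → ZMod 3`): L(2) for door I1⁗. -/
theorem soloBlind_seqRep_two_card_le_four_F3 {r : ℕ} (h : ι → (Fin r → ZMod 3)) (S : Finset ι)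
    (zsf : ∀ T ⊆ S, T.Nonempty → ∑ i ∈ T, h i ≠ 0) (τ : Fin r → ZMod 3) :
    (soloBlindSeqRep h S 2 τ).card ≤ 4 := by
  refine soloBlind_seqRep_two_card_le_four ?_ h S zsf τ
  intro g
  funext i
  have h3 : ∀ a : ZMod 3, a + a + a = 0 := by decide
  exact h3 (g i)

/-- SHARPNESS: the doubled basis `(e₀, e₀, e₁, e₁)` of `𝔽₃²` is zero-sum free and `τ = e₀ + e₁` has exactly
four size-`2` representations. -/
theorem soloBlind_seqRep_two_four_attained :
    let h : Fin 4 → (Fin 2 → ZMod 3) := ![![1, 0], ![1, 0], ![0, 1], ![0, 1]]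
    (∀ T ⊆ (Finset.univ : Finset (Fin 4)), T.Nonempty → ∑ i ∈ T, h i ≠ 0) ∧
      (soloBlindSeqRep h Finset.univ 2 ![1, 1]).card = 4 := by
  refine ⟨?_, ?_⟩
  · intro T _ hTne
    revert T
    decide
  · decide

end Summit.MatrixMultiplication.MatrixMultiplication.Theorems
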